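import Literature.Computability.FineGrained.OVFromSETHReductionProgram
import Literature.Computability.FineGrained.CliqueETHGroupingReduction
import HarnessLib

/-!
# SETH ⇒ OV: Williams' split-and-list reduction on the word RAM (proof of the named fact)

The proof of the named fact `sparseKSATInRAMTime_of_ov_subquadratic` of `…FineGrained.OVFromSETH`
(R. Williams, *A new algorithm for optimal 2-constraint satisfaction and its implications*,
TCS 348 (2005), §5.1, Thm. 5.1 — Theorem 5 of the author's version; V. Vassilevska Williams,
Proc. ICM 2018, §3, proof of Thm. 3.1): if for some `0 < ε ≤ 1` and every `c ≥ 1` Orthogonal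
Vectors in dimension `d = c ⌊log₂ n⌋` has a deterministic `O(n^{2-ε})` word-RAM algorithm, then for
every width `k`, density `c'` and `δ > 1 - ε/2` the `k`-CNFs with at most `c' n` clauses are decided
on the word RAM in time `O(2^{δ n})` (`SparseKSATInRAMTime k c' δ`). With the build of
`…OVFromSETHReductionProgram` (the OV encoding of the split-and-list instance `OVRed.splitOV φ c` of
`…OVFromSETHSplitInstance`, `c = 2 c' + 2`) in hand, this file supplies, exactly along the lines of
`…CliqueETHGroupingReduction`,

* **the run** (`Params.reduction_outputsWithin`): the emulator's side conditions
  (`Params.envOK`), the target invariant and the agreement of the emulated memory with the initial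
  memory of the OV program on the split instance at the end of the build (`Params.tinv_finMem`,
  `Params.agree_finMem`), the read-out (`Params.post_spec`), whence by `SProg.outputsWithin_withSubrun`
  the reduction program outputs the OV program's answer bit — `[1]` iff `φ` is satisfiable, by
  `hasOrthogonalPair_splitOV_iff` — within `Tpre + 38 T + 4` steps;
* **the word size** (`Params.kfit`, `Params.fits`): at `W = kfit · (n + inputWidth x)` everything
  fits, for formulas with `m ≤ c' n` clauses;
* **the time** (`Params.Tpre_le`, `Params.N_real_le`, `Params.N_rpow_le`, `Params.Tpre_real_le`):
  the build costs `O_{k,c'}(N · (|x| + n))`, `N = 2^{⌈n/2⌉} ≤ 2 · 2^{n/2}`, hence `O(2^{δ n})` for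
  `δ > 1/2`, and the emulated run costs `38 ⌊C N^{2-ε} + C⌋ = O(2^{(1-ε/2) n}) = O(2^{δ n})`;
* **the named fact** `sparseKSATInRAMTime_of_ov_subquadratic_holds`.

## References

* R. Williams, *A new algorithm for optimal 2-constraint satisfaction and its implications*,
  Theoret. Comput. Sci. 348 (2005) 357–365, §5.1 (Thm. 5.1; Theorem 5 of the author's version).
* V. Vassilevska Williams, *On some fine-grained questions in algorithms and complexity*,
  Proc. ICM 2018, §2 (word RAM), §3 Thm. 3.1 (proof).
-/


namespace Literature.Computability.FineGrained

open Cryptography Cryptography.WordRAM Complexity Cryptography.WordRAM.SProg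

namespace OVRed

open CliqueRed (r pt im lay)
open SplitList (half half_le le_two_mul_half)

namespace Params

variable (g : Params) {W : ℕ} {O : List ℕ → List ℕ}

/-! ### The run -/

/-- The emulator's side conditions hold for the reduction's layout and environment. [folklore] -/
theorem envOK (hF : g.Fits W) : EnvOK lay g.env W := by
  obtain ⟨hX, hXLx, hBv, hSv, htop, -⟩ := g.facts hF
  refine ⟨by decide, by decide, by decide, by decide, by decide, by decide, by decide,
    fun r hr => ?_, Or.inl ?_, ?_, ?_, hF.ws_lt.le⟩
  · simp only [lay, Layout.regs, List.mem_cons, List.not_mem_nil, or_false] at hr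
    show r < g.Bv ∧ r < g.Sv
    rcases hr with rfl | rfl | rfl | rfl | rfl | rfl | rfl <;> omega
  · show g.Bv + (g.V + 1) ≤ g.Sv; omega
  · show g.Bv + (g.V + 1) ≤ 2 ^ W; omega
  · show g.Sv + (g.V + 1) ≤ 2 ^ W; omega

/-- Every cell of the final memory is below `2 ^ W`. [folklore] -/
theorem finMem_lt (hF : g.Fits W) (a : ℕ) : g.finMem a < 2 ^ W := by
  obtain ⟨hX, hXLx, hBv, hSv, htop, hNdV, hPwV, -⟩ := g.facts hF
  unfold finMem
  by_cases ha : a < 100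
  · rw [if_pos ha]; split_ifs <;> omega
  rw [if_neg ha]
  unfold finData
  split_ifs
  · exact lt_of_le_of_lt (CliqueRed.relocated_le_of_forall (B := 2 ^ W - 1)
      (fun v hv => Nat.le_sub_one_of_lt (hF.input v hv)) (by omega)) (by omega)
  · have := g.ycell_lt_Pw (a - g.Bv); omega

/-- The emulated cells are the initial memory of the OV program on `y` at word size `ws`.
[folklore] -/
theorem ycell_eq_init (j : ℕ) : g.ycell j = (init g.ws g.y).mem j := by
  have hlen : g.y.length = 2 * g.Nd + 2 := by
    unfold y Nd; rw [length_encode_splitOV, ← g.N_eq, ← g.d_eq]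
  unfold ycell
  rcases Nat.eq_zero_or_pos j with rfl | hj
  · rw [if_pos rfl, init_mem_zero, hlen]; rfl
  · obtain ⟨i, rfl⟩ := Nat.exists_eq_add_of_le' hj
    rw [if_neg (by omega), Nat.add_sub_cancel]
    by_cases hi : i < g.y.length
    · rw [init_mem_succ _ _ _ hi, List.getD_eq_getElem _ _ hi]; rfl
    · rw [init_mem_of_length_lt _ _ _ (by omega), List.getD_eq_default _ _ (by omega)]; simp

/-- The stamps of the final memory are `0`. [folklore] -/
theorem finMem_stamp (hF : g.Fits W) (a : ℕ) : g.finMem (g.Sv + a) = 0 := by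
  obtain ⟨hX, hXLx, hBv, hSv, htop, hNdV, -⟩ := g.facts hF
  unfold finMem finData
  rw [if_neg (by omega), if_neg (by omega)]
  exact g.ycell_of_le (by omega)

/-- **The target invariant at the end of the build.** [folklore] -/
theorem tinv_finMem (hF : g.Fits W) : TInv lay g.env (2 ^ W - 1) g.finMem := by
  refine ⟨⟨?_, ?_, ?_, ?_⟩, fun a _ => ?_, fun a => Nat.le_sub_one_of_lt (g.finMem_lt hF a)⟩
  · show g.finMem 10 = g.Bv; simp [finMem]
  · show g.finMem 11 = g.Sv; simp [finMem]
  · show g.finMem 12 = 0; simp [finMem]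
  · show g.finMem 13 = 2 ^ g.ws; simp [finMem]; rfl
  · show g.finMem (g.Sv + a) ≤ 0
    rw [g.finMem_stamp hF a]

/-- **The emulated input is in place at the end of the build**: the emulated memory is the initial
memory of the OV program on `y` at word size `ws`. [folklore] -/
theorem agree_finMem (hF : g.Fits W) : Agree g.env g.finMem (init g.ws g.y).mem := by
  obtain ⟨hX, hXLx, hBv, hSv, -⟩ := g.facts hF
  intro a _
  show (if g.finMem (g.Sv + a) = 0 then g.finMem (g.Bv + a) else 0) = (init g.ws g.y).mem a
  rw [if_pos (g.finMem_stamp hF a), ← g.ycell_eq_init]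
  unfold finMem finData
  rw [if_neg (by omega), if_neg (by omega), Nat.add_sub_cancel_left]

/-- **The read-out.** From any memory agreeing with the halting memory `dm` of the OV program
(target invariant kept), `post` outputs `[dm 1]` in `3` steps. [folklore] -/
theorem post_spec (hF : g.Fits W) {m₂ dm : ℕ → ℕ} (hag : Agree g.env m₂ dm)
    (hI : TInv lay g.env (2 ^ W - 1) m₂) (qs : List (List ℕ)) :
    ∃ (st₃ : Store) (t₃ : ℕ), t₃ ≤ 3 ∧ Exec W O CliqueRed.post ⟨m₂, qs⟩ st₃ t₃ ∧
      readOut st₃.mem = [dm 1] := by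
  obtain ⟨hX, hXLx, hBv, hSv, htop, hNdV, -⟩ := g.facts hF
  have h10 : m₂ 10 = g.Bv := hI.env.1
  have hst : m₂ (g.Sv + 1) = 0 := Nat.le_zero.1 (hI.stamp 1 (by show 1 < g.V + 1; omega))
  have h1 : m₂ (g.Bv + 1) = dm 1 := by
    have := hag 1 (by show 1 < g.V + 1; omega)
    simp only [edec, Params.env, hst, if_true] at this
    exact this
  refine ⟨_, 3, le_rfl, Exec.block _ m₂ qs, ?_⟩
  have hm : execOps W m₂ [(.add, r 17, r 10, im 1), (.band, r 1, pt 17, pt 17), (.band, r 0, im 1,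
    im 1)] =
      Function.update (Function.update (Function.update m₂ 17 (g.Bv + 1)) 1 (dm 1)) 0 1 := by
    simp (disch := first | omega | decide) only [execOps_cons, execOps_nil, execOp, Operand.write,
      Operand.read, Function.update_self, Function.update_of_ne, h10, BinOp.eval_add_of_lt,
      BinOp.eval_band, Nat.and_self]
    rw [h1]
  show readOut (execOps W m₂ _) = _
  rw [hm]
  simp [readOut, readSeg, Function.update_self, Function.update_of_ne]

/-- The total time of the reduction program, given a time bound `T` for the OV program.
[folklore] -/
def Ttotal (k T : ℕ) : ℕ := g.Tpre k + cstep * T + 4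

/-- **The reduction program's output.** At a word size `W` with `g.Fits W` (width `≤ k`), if the
deterministic oracle-free OV program `M` (largest constant `cM`) outputs `[bit]` on the split
instance `y` at word size `ws = kM · width` within `T` steps, then the reduction program outputs
`[bit]` on `x = encodeCNFWords φ` within `Tpre + 38 T + 4` steps. [folklore] -/
theorem reduction_outputsWithin (hF : g.Fits W) {k : ℕ} (hw : g.φ.IsWidthLE k)
    {M : Program} (hdet : M.IsDeterministic) (hof : M.IsOracleFree) (hcM : M.maxConst = g.cM)
    {T bit : ℕ} (hM : OutputsWithin M g.ws noOracle zeroCoins g.y [bit] T) :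
    OutputsWithin (withSubrun (pre g.c g.kM g.cM) lay M CliqueRed.post) W noOracle zeroCoins g.x
      [bit] (g.Ttotal k T) := by
  obtain ⟨hX, hXLx, hBv, hSv, htop, hNdV, hPwV, hcMV, -⟩ := g.facts hF
  have hW1 : 1 ≤ W := by have := hF.ws_lt; omega
  have h2W : 2 ≤ 2 ^ W := by
    calc (2 : ℕ) = 2 ^ 1 := rfl
      _ ≤ 2 ^ W := Nat.pow_le_pow_right (by norm_num) hW1
  obtain ⟨st₁, t₁, ht₁, hexec, hmem, hqs⟩ := (g.pre_spec (O := noOracle) hF hw).exists_exec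
  obtain ⟨dh, hhalt, hout⟩ := (outputsWithin_iff_exists_haltsWithin _ _ _ _ _ _ _).1 hM
  have hst₁ : st₁ = ⟨g.finMem, []⟩ := by cases st₁; simp only at hmem hqs; rw [hmem, hqs]
  subst hst₁
  have key := outputsWithin_withSubrun (O := noOracle) zeroCoins (pre := pre g.c g.kM g.cM)
    (post := CliqueRed.post) (L := lay) (E := g.env) (VT := 2 ^ W - 1) (V := g.V) (M := M)
    (x := g.x) (y := g.y) (out := [bit]) (T₂ := 3) hF.width hexec (g.envOK hF) (by omega)
    (by omega)
    (fun r hr => by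
      simp only [lay, Layout.regs, List.mem_cons, List.not_mem_nil, or_false] at hr
      rcases hr with rfl | rfl | rfl | rfl | rfl | rfl | rfl <;> omega)
    hdet hof (by rw [hcM]; exact hcMV) (by show g.V < g.V + 1; omega) (by omega)
    (by show 2 ^ g.ws - 1 ≤ g.V; have := g.le_V; unfold Pw at this; omega) (by omega)
    (g.tinv_finMem hF) (g.agree_finMem hF) hhalt
    (fun m₂ hag hI _ => by
      have := g.post_spec (O := noOracle) hF hag hI []
      rwa [CliqueRed.mem_one_of_readOut hout] at this)
  exact key.mono (by unfold Ttotal; omega)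

/-! ### The size of the build -/

/-- `Lx = 2 + m + size ≤ 2 + (k + 1) m` for width `≤ k`. [folklore] -/
theorem Lx_le {k : ℕ} (hw : g.φ.IsWidthLE k) : g.Lx ≤ 2 + (k + 1) * g.m := by
  have := size_le_mul_of_isWidthLE hw
  unfold Lx x m at *
  rw [length_encodeCNFWords_eq, CNF.numClauses]
  nlinarith

/-- `h ≤ n`, `d ≤ c n`, `Nd ≤ c N n`. [folklore] -/
theorem d_le : g.d ≤ g.c * g.n ∧ g.Nd ≤ g.c * (g.N * g.n) := by
  have hh : g.h ≤ g.n := half_le _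
  refine ⟨Nat.mul_le_mul_left _ hh, ?_⟩
  unfold Nd d
  calc g.N * (g.c * g.h) ≤ g.N * (g.c * g.n) := Nat.mul_le_mul_left _ (Nat.mul_le_mul_left _ hh)
    _ = g.c * (g.N * g.n) := by ring

/-- **The running time of the build**: `O_{k,c}(N · (Lx + n + 1))`. [folklore] -/
theorem Tpre_le (k : ℕ) : g.Tpre k ≤ (34 * k + 8 * g.c + 210) * (g.N * (g.Lx + g.n + 1)) := by
  have hN : 1 ≤ g.N := g.one_le_N
  have hLx : 2 ≤ g.Lx := g.two_le_Lx
  have hm : g.m ≤ g.Lx := by have := g.m_add_two_le_Lx; omega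
  have hσ : Nat.size (2 * g.Nd + 2) ≤ 2 * g.Nd + 2 := CliqueRed.size_le_self _
  obtain ⟨-, hNd⟩ := g.d_le
  set P := g.N * (g.Lx + g.n + 1) with hP
  have hP1 : g.Lx + g.n + 1 ≤ P := Nat.le_mul_of_pos_left _ hN
  have hPN : g.N ≤ P := Nat.le_mul_of_pos_right _ (by omega)
  have hNn : g.N * g.n ≤ P := Nat.mul_le_mul_left _ (by omega)
  have hNLx : g.N * g.Lx ≤ P := Nat.mul_le_mul_left _ (by omega)
  unfold Tpre Trows Trow Trp Tcl
  -- the rows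
  have hrows : g.N * (g.m * (17 * k + 10 + 2) + 4 + 8 + 2) + 3 ≤ (17 * k + 12) * P + 17 * P := by
    have h1 : g.m * (17 * k + 10 + 2) ≤ (17 * k + 12) * g.Lx := by
      rw [Nat.mul_comm]; exact Nat.mul_le_mul_left _ hm
    calc g.N * (g.m * (17 * k + 10 + 2) + 4 + 8 + 2) + 3
        ≤ g.N * ((17 * k + 12) * g.Lx + 14) + 3 := by
          have := Nat.mul_le_mul_left g.N (show g.m * (17 * k + 10 + 2) + 4 + 8 + 2 ≤
            (17 * k + 12) * g.Lx + 14 by omega); omega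
      _ = (17 * k + 12) * (g.N * g.Lx) + 14 * g.N + 3 := by ring
      _ ≤ (17 * k + 12) * P + 14 * P + 3 * P := by
          have := Nat.mul_le_mul_left (17 * k + 12) hNLx; nlinarith
      _ = (17 * k + 12) * P + 17 * P := by ring
  have hsize : Nat.size (2 * g.Nd + 2) * 4 + 1 ≤ (8 * g.c) * P + 9 * P := by
    calc Nat.size (2 * g.Nd + 2) * 4 + 1 ≤ (2 * g.Nd + 2) * 4 + 1 := by omega
      _ ≤ (2 * (g.c * (g.N * g.n)) + 2) * 4 + 1 := by omega
      _ = (8 * g.c) * (g.N * g.n) + 9 := by ring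
      _ ≤ (8 * g.c) * P + 9 * P := by
          have := Nat.mul_le_mul_left (8 * g.c) hNn; nlinarith
  have hLx' : 7 * g.Lx ≤ 7 * P := by nlinarith
  have hconst : 14 + 16 + 10 + 96 ≤ 136 * P := by nlinarith
  calc 7 * g.Lx + 14 + (Nat.size (2 * g.Nd + 2) * 4 + 1) + 16 + 10 +
        (g.N * (g.m * (17 * k + 10 + 2) + 4 + 8 + 2) + 3) +
        (g.N * (g.m * (17 * k + 10 + 2) + 4 + 8 + 2) + 3) + 96
      ≤ 7 * P + ((8 * g.c) * P + 9 * P) + 2 * ((17 * k + 12) * P + 17 * P) + 136 * P := by omega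
    _ = (34 * k + 8 * g.c + 210) * P := by ring

/-! ### The word-size constant -/

/-- **The word-size constant** of the reduction: with `W = kfit · (n + inputWidth x)` every
address and value of the run fits (`fits`). [folklore] -/
def kfit (kM cM c : ℕ) : ℕ :=
  Nat.size (2 * cM + 4 * c + 114) + kM * Nat.size (2 * c + 2) + 2 * kM + 4

/-- **The word size fits.** For a formula with `m ≤ c' n` clauses and `c = 2 c' + 2`, the run at
word size `kfit · (n + inputWidth x)` satisfies `Fits`. [folklore] -/
theorem fits {c' : ℕ} (hc : g.c = 2 * c' + 2) (hm : g.m ≤ c' * g.n) :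
    g.Fits (kfit g.kM g.cM g.c * (g.n + inputWidth g.x)) := by
  -- notation
  set n := g.n with hn
  set w := inputWidth g.x with hw
  set A := 2 * g.cM + 4 * g.c + 114 with hA
  set sA := Nat.size (2 * g.c + 2) with hsA
  have hw1 : 1 ≤ w := inputWidth_pos _
  have hLx : g.Lx < 2 ^ w := length_lt_two_pow_inputWidth _
  obtain ⟨hX, hBv, hSv⟩ := g.bases
  have hc1 : 1 ≤ g.c := by omega
  -- h, N, d, Nd
  have hh2 : 2 * g.h ≤ n + 1 := by show 2 * half g.n ≤ g.n + 1; unfold half; omega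
  have hhn : g.h ≤ n := half_le _
  have hn2 : n ≤ 2 ^ n := Nat.lt_two_pow_self.le
  obtain ⟨hdn, hNd⟩ := g.d_le
  have hNle : g.N ≤ 2 ^ n := Nat.pow_le_pow_right Nat.two_pos hhn
  have hNN : g.N * g.N ≤ 2 ^ (n + 1) := by
    unfold N; rw [← Nat.pow_add]; exact Nat.pow_le_pow_right Nat.two_pos (by omega)
  have hNd2 : 2 * g.Nd + 2 ≤ (2 * g.c + 2) * 2 ^ (2 * n) := by
    have h1 : g.Nd ≤ g.c * 2 ^ (2 * n) := by
      calc g.Nd ≤ g.c * (g.N * g.n) := hNd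
        _ ≤ g.c * (2 ^ n * 2 ^ n) := Nat.mul_le_mul_left _ (Nat.mul_le_mul hNle hn2)
        _ = g.c * 2 ^ (2 * n) := by rw [← Nat.pow_add, Nat.two_mul]
    have h2 : 2 ≤ 2 * 2 ^ (2 * n) := by have := Nat.one_le_two_pow (n := 2 * n); omega
    calc 2 * g.Nd + 2 ≤ 2 * (g.c * 2 ^ (2 * n)) + 2 * 2 ^ (2 * n) := by omega
      _ = (2 * g.c + 2) * 2 ^ (2 * n) := by ring
  -- σ, ws
  have hσ : Nat.size (2 * g.Nd + 2) ≤ sA + 2 * n := by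
    have := Nat.size_le_size hNd2
    rwa [← Nat.shiftLeft_eq, Nat.size_shiftLeft (by positivity)] at this
  have hws : g.ws ≤ g.kM * sA + 2 * (g.kM * n) := by
    have : g.ws ≤ g.kM * (sA + 2 * n) := Nat.mul_le_mul_left _ hσ
    have e : g.kM * (sA + 2 * n) = g.kM * sA + 2 * (g.kM * n) := by ring
    omega
  -- the exponent
  set E := w + 2 * n + g.ws with hE
  have h2E : ∀ t, t ≤ E → 2 ^ t ≤ 2 ^ E := fun t ht => Nat.pow_le_pow_right Nat.two_pos ht
  have hV : g.V ≤ 2 ^ g.ws + g.cM + (2 * g.Nd + 2) := by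
    unfold V Pw; have := Nat.one_le_two_pow (n := g.ws); omega
  have hBvle : g.Bv ≤ 103 * 2 ^ E := by
    have e1 : 2 * g.Lx ≤ 2 * 2 ^ E := by have := h2E w (by omega); omega
    have e2 : 101 ≤ 101 * 2 ^ E := CliqueRed.le_self_mul_two_pow _ _
    have : g.Bv = 2 * g.Lx + 101 := by rw [← hBv]; unfold X; ring
    rw [this, show (103 : ℕ) = 2 + 101 by rfl]
    exact CliqueRed.add_le_mul_two_pow e1 e2
  have hVle : 2 * g.V + 2 ≤ (2 * g.cM + 4 * g.c + 8) * 2 ^ E := by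
    have e1 : 2 * 2 ^ g.ws ≤ 2 * 2 ^ E := Nat.mul_le_mul_left _ (h2E _ (by omega))
    have e2 : 2 * g.cM ≤ 2 * g.cM * 2 ^ E := CliqueRed.le_self_mul_two_pow _ _
    have e3 : 2 * (2 * g.Nd + 2) ≤ 2 * (2 * g.c + 2) * 2 ^ E := by
      rw [Nat.mul_assoc]
      exact Nat.mul_le_mul_left _ (hNd2.trans (Nat.mul_le_mul_left _ (h2E _ (by omega))))
    have e4 : 2 ≤ 2 * 2 ^ E := CliqueRed.le_self_mul_two_pow _ _
    have h := CliqueRed.add_le_mul_two_pow (CliqueRed.add_le_mul_two_pow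
      (CliqueRed.add_le_mul_two_pow e1 e2) e3) e4
    rw [show 2 + 2 * g.cM + 2 * (2 * g.c + 2) + 2 = 2 * g.cM + 4 * g.c + 8 by ring] at h
    omega
  have htot : g.Sv + g.V + 1 ≤ 2 ^ (Nat.size A + E) := by
    have h := CliqueRed.add_le_mul_two_pow hBvle hVle
    rw [show 103 + (2 * g.cM + 4 * g.c + 8) = A + (0 + 0) - 3 by rw [hA]; omega] at h
    have h' : g.Bv + (2 * g.V + 2) ≤ A * 2 ^ E :=
      h.trans (Nat.mul_le_mul_right _ (by omega))
    exact le_trans (by omega) (h'.trans (CliqueRed.mul_two_pow_le_two_pow_size_add A E))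
  -- the word size
  set sB := Nat.size A with hsB
  have hkfit : kfit g.kM g.cM g.c = sB + g.kM * sA + 2 * g.kM + 4 := rfl
  have hW : sB + E + 1 ≤ kfit g.kM g.cM g.c * (n + w) := by
    rw [hkfit, Nat.mul_add]
    have h1 : (2 * g.kM + 4) * n ≤ (sB + g.kM * sA + 2 * g.kM + 4) * n :=
      Nat.mul_le_mul_right _ (by omega)
    have h2 : (sB + g.kM * sA + 4) * w ≤ (sB + g.kM * sA + 2 * g.kM + 4) * w :=
      Nat.mul_le_mul_right _ (by omega)
    have h3 : (sB + g.kM * sA) + w + 3 ≤ (sB + g.kM * sA + 4) * w := by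
      rw [Nat.add_mul _ 4 w]
      have := Nat.le_mul_of_pos_right (sB + g.kM * sA) hw1
      omega
    have h4 : (2 * g.kM + 4) * n = 2 * (g.kM * n) + 2 * n + 2 * n := by ring
    omega
  refine ⟨htot.trans (Nat.pow_le_pow_right Nat.two_pos (by omega)), by omega, ?_, by omega, ?_⟩
  · exact lt_of_le_of_lt hNN (Nat.pow_lt_pow_right (by norm_num) (by omega))
  · -- `m ≤ c' n ≤ (c' + 1) (2 h) ≤ (2 c' + 2) h = d`
    show g.m ≤ g.c * g.h
    rw [hc]
    have hn2h : n ≤ 2 * g.h := le_two_mul_half _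
    calc g.m ≤ c' * n := hm
      _ ≤ c' * (2 * g.h) := Nat.mul_le_mul_left _ hn2h
      _ ≤ (2 * c' + 2) * g.h := by nlinarith

end Params

end OVRed

end Literature.Computability.FineGrained

namespace Literature.Computability.FineGrained

open Filter Topology Cryptography Cryptography.WordRAM Complexity Cryptography.WordRAM.SProg

namespace OVRed

open SplitList (half half_le le_two_mul_half)

namespace Params

variable (g : Params)

/-! ### The time in real terms -/

/-- `N = 2^{⌈n/2⌉} ≤ 2 · 2^{n/2}`. [folklore] -/
theorem N_real_le : (g.N : ℝ) ≤ 2 * (2 : ℝ) ^ ((g.n : ℝ) / 2) := by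
  have hh2 : 2 * g.h ≤ g.n + 1 := by show 2 * half g.n ≤ g.n + 1; unfold half; omega
  have hhR : (g.h : ℝ) ≤ (g.n : ℝ) / 2 + 1 / 2 := by
    have : (2 : ℝ) * g.h ≤ g.n + 1 := by exact_mod_cast hh2
    linarith
  have hN : (g.N : ℝ) = (2 : ℝ) ^ (g.h : ℝ) := by
    unfold N; push_cast; rw [Real.rpow_natCast]
  rw [hN]
  calc (2 : ℝ) ^ (g.h : ℝ) ≤ (2 : ℝ) ^ ((g.n : ℝ) / 2 + 1 / 2) :=
        Real.rpow_le_rpow_of_exponent_le one_le_two hhR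
    _ = (2 : ℝ) ^ ((g.n : ℝ) / 2) * (2 : ℝ) ^ ((1 : ℝ) / 2) := by rw [Real.rpow_add (by norm_num)]
    _ ≤ (2 : ℝ) ^ ((g.n : ℝ) / 2) * 2 := by
        gcongr
        calc (2 : ℝ) ^ ((1 : ℝ) / 2) ≤ (2 : ℝ) ^ (1 : ℝ) :=
              Real.rpow_le_rpow_of_exponent_le one_le_two (by norm_num)
          _ = 2 := Real.rpow_one 2
    _ = 2 * (2 : ℝ) ^ ((g.n : ℝ) / 2) := by ring

/-- `N^{2-ε} ≤ 2 · 2^{(1-ε/2) n}` for `0 ≤ ε ≤ 2`. [folklore] -/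
theorem N_rpow_le {ε : ℝ} (hε0 : 0 ≤ ε) (hε : ε ≤ 2) :
    (g.N : ℝ) ^ (2 - ε) ≤ 2 * (2 : ℝ) ^ ((1 - ε / 2) * g.n) := by
  have hh2 : 2 * g.h ≤ g.n + 1 := by show 2 * half g.n ≤ g.n + 1; unfold half; omega
  have hhR : (g.h : ℝ) ≤ ((g.n : ℝ) + 1) / 2 := by
    have : (2 : ℝ) * g.h ≤ g.n + 1 := by exact_mod_cast hh2
    linarith
  have hN : (g.N : ℝ) = (2 : ℝ) ^ (g.h : ℝ) := by
    unfold N; push_cast; rw [Real.rpow_natCast]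
  have h2ε : 0 ≤ 2 - ε := by linarith
  rw [hN, ← Real.rpow_mul (by norm_num)]
  calc (2 : ℝ) ^ ((g.h : ℝ) * (2 - ε)) ≤ (2 : ℝ) ^ (((g.n : ℝ) + 1) / 2 * (2 - ε)) :=
        Real.rpow_le_rpow_of_exponent_le one_le_two (mul_le_mul_of_nonneg_right hhR h2ε)
    _ = (2 : ℝ) ^ (1 - ε / 2) * (2 : ℝ) ^ ((1 - ε / 2) * g.n) := by
        rw [← Real.rpow_add (by norm_num)]; ring_nf
    _ ≤ 2 * (2 : ℝ) ^ ((1 - ε / 2) * g.n) := by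
        gcongr
        calc (2 : ℝ) ^ (1 - ε / 2) ≤ (2 : ℝ) ^ (1 : ℝ) :=
              Real.rpow_le_rpow_of_exponent_le one_le_two (by linarith)
          _ = 2 := Real.rpow_one 2

/-- **The running time of the build in real terms**: for width `≤ k`, `m ≤ c' n` and `η > 0`, the
build plus read-out costs at most `C_b · 2^{(1/2 + η) n}` for an explicit `C_b = C_b(k, c, c', C₃)`,
given the polynomial-vs-exponential constant `C₃` of exponent `η`. [folklore] -/
theorem Tpre_real_le {k c' : ℕ} (hw : g.φ.IsWidthLE k) (hm : g.m ≤ c' * g.n) {η : ℝ} (hη : 0 ≤ η)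
    {C₃ : ℝ} (hpoly : ∀ n : ℕ, ((n : ℝ) + 1) ^ 2 ≤ C₃ * (2 : ℝ) ^ (η * n)) :
    (g.Tpre k : ℝ) + 4 ≤
      ((34 * k + 8 * g.c + 210) * (2 * (((k : ℝ) + 1) * c' + 3) * C₃) + 4) *
        (2 : ℝ) ^ ((1 / 2 + η) * g.n) := by
  set n := g.n with hn
  have hn0 : (0 : ℝ) ≤ n := Nat.cast_nonneg _
  have hT := g.Tpre_le k
  have hLx := g.Lx_le hw
  -- real forms
  have e1 : (1 : ℝ) ≤ (2 : ℝ) ^ ((1 / 2 + η) * n) :=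
    Real.one_le_rpow (by norm_num) (by positivity)
  have e4 : (2 : ℝ) ^ ((n : ℝ) / 2) * (2 : ℝ) ^ (η * n) = (2 : ℝ) ^ ((1 / 2 + η) * n) := by
    rw [← Real.rpow_add (by norm_num)]; ring_nf
  have hpn := hpoly n
  have hN := g.N_real_le
  -- casts of the natural bounds
  have cT : (g.Tpre k : ℝ) ≤ (34 * k + 8 * g.c + 210) * ((g.N : ℝ) * ((g.Lx : ℝ) + n + 1)) := by
    have : ((g.Tpre k : ℕ) : ℝ) ≤ (((34 * k + 8 * g.c + 210) * (g.N * (g.Lx + g.n + 1)) : ℕ) : ℝ) := by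
      exact_mod_cast hT
    simpa [Nat.cast_mul, Nat.cast_add] using this
  have cLx : (g.Lx : ℝ) + n + 1 ≤ (((k : ℝ) + 1) * c' + 3) * ((n : ℝ) + 1) ^ 2 := by
    have h1 : (g.Lx : ℝ) ≤ 2 + ((k : ℝ) + 1) * (c' * n) := by
      have : ((g.Lx : ℕ) : ℝ) ≤ ((2 + (k + 1) * g.m : ℕ) : ℝ) := by exact_mod_cast hLx
      have hm' : ((g.m : ℕ) : ℝ) ≤ ((c' * n : ℕ) : ℝ) := by exact_mod_cast hm
      push_cast at this hm'
      nlinarith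
    have hk0 : (0 : ℝ) ≤ k := Nat.cast_nonneg _
    have hc0 : (0 : ℝ) ≤ c' := Nat.cast_nonneg _
    nlinarith [sq_nonneg (n : ℝ), mul_nonneg hk0 hc0, mul_nonneg (mul_nonneg hk0 hc0) hn0,
      mul_nonneg hc0 hn0]
  -- assemble
  have hA : (g.N : ℝ) * ((g.Lx : ℝ) + n + 1) ≤
      2 * (((k : ℝ) + 1) * c' + 3) * C₃ * (2 : ℝ) ^ ((1 / 2 + η) * n) := by
    calc (g.N : ℝ) * ((g.Lx : ℝ) + n + 1)
        ≤ (2 * (2 : ℝ) ^ ((n : ℝ) / 2)) * ((((k : ℝ) + 1) * c' + 3) * ((n : ℝ) + 1) ^ 2) := by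
          gcongr
      _ ≤ (2 * (2 : ℝ) ^ ((n : ℝ) / 2)) * ((((k : ℝ) + 1) * c' + 3) * (C₃ * (2 : ℝ) ^ (η * n))) := by
          gcongr
      _ = 2 * (((k : ℝ) + 1) * c' + 3) * C₃ * ((2 : ℝ) ^ ((n : ℝ) / 2) * (2 : ℝ) ^ (η * n)) := by
          ring
      _ = _ := by rw [e4]
  have h4 : (4 : ℝ) ≤ 4 * (2 : ℝ) ^ ((1 / 2 + η) * n) := by nlinarith
  have hK : (0 : ℝ) ≤ 34 * k + 8 * g.c + 210 := by positivity
  calc (g.Tpre k : ℝ) + 4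
      ≤ (34 * k + 8 * g.c + 210) * ((g.N : ℝ) * ((g.Lx : ℝ) + n + 1)) + 4 := by linarith
    _ ≤ (34 * k + 8 * g.c + 210) * (2 * (((k : ℝ) + 1) * c' + 3) * C₃ * (2 : ℝ) ^ ((1 / 2 + η) * n)) +
          4 * (2 : ℝ) ^ ((1 / 2 + η) * n) := by
        gcongr
    _ = _ := by ring

end Params

/-! ### The named fact -/

/-- **Williams' split-and-list reduction on the word RAM (proof of the named fact
`sparseKSATInRAMTime_of_ov_subquadratic`).** If for some `0 < ε ≤ 1` and every `c ≥ 1` OV in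
dimension `c ⌊log₂ n⌋` has a deterministic `O(n^{2-ε})` word-RAM algorithm, then for every `k`,
every density `c'` and every `δ > 1 - ε/2`, the `k`-CNFs with `m ≤ c' n` clauses are decided on the
word RAM in time `O(2^{δ n})`: take the OV program for `c = 2 c' + 2` (so that all `m ≤ c' n ≤ c ⌈n/2⌉`
clauses fit into the dimension); run the reduction program (`reduction_outputsWithin`) —
relocation, header and the `2N` rows of the OV encoding of the split instance
(`hasOrthogonalPair_splitOV_iff`), one emulated run of the OV program, read-out — at word size
`kfit · (n + width)`; the build costs `O(N (|x| + n)) = O(2^{n/2} poly(n)) = O(2^{δ n})`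
(`Tpre_real_le`, as `δ > 1/2`) and the emulated run `38 ⌊C N^{2-ε} + C⌋ = O(2^{(1-ε/2) n}) = O(2^{δ n})`
(`N_rpow_le`). [cite: WilliamsTCS2005, §5.1 (Thm. 5.1; Theorem 5 of the author's version)]
[cite: VassilevskaWilliamsICM2018, §3 Thm. 3.1 (proof)] -/
theorem _root_.Literature.Computability.FineGrained.sparseKSATInRAMTime_of_ov_subquadratic_holds :
    sparseKSATInRAMTime_of_ov_subquadratic := by
  classical
  intro ε hε hε1 hOV k c' δ hδ
  -- the OV program in dimension `c = 2 c' + 2`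
  obtain ⟨CM, M, kM, hdet, hof, hM⟩ := hOV (2 * c' + 2) (by omega)
  -- the exponents
  have hδhalf : 1 / 2 < δ := by linarith
  set η : ℝ := δ - 1 / 2 with hη
  have hη0 : 0 < η := by linarith
  obtain ⟨C₃, hC₃, hpoly⟩ := CliqueRed.exists_sq_le_two_rpow hη0
  -- the program and the constants
  set cM := M.maxConst with hcM
  set c := 2 * c' + 2 with hc
  set Cb : ℝ := (34 * k + 8 * c + 210) * (2 * (((k : ℝ) + 1) * c' + 3) * C₃) + 4 with hCb
  have hCb0 : 0 ≤ Cb := by positivity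
  set CM' : ℝ := max CM 0 with hCM'
  have hCM'0 : 0 ≤ CM' := le_max_right _ _
  refine ⟨reduction M c kM, Params.kfit kM cM c, Cb + 114 * CM', reduction_isDeterministic M c kM,
    reduction_isOracleFree M c kM, fun φ hsparse => ?_⟩
  -- one instance
  obtain ⟨hwk, -⟩ := φ.2
  set g : Params := ⟨φ.1, c, kM, cM⟩ with hgdef
  have hsize : (kSATProblem k).size φ = g.n := rfl
  have hwidth : (kSATProblem k).width φ = inputWidth g.x := rfl
  have henc : (kSATProblem k).encode φ = g.x := rfl
  rw [hsize] at hsparse ⊢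
  rw [hwidth, henc]
  have hm : g.m ≤ c' * g.n := hsparse
  have hF := g.fits rfl hm
  have hmd : g.φ.length ≤ g.c * half g.φ.numVars := hF.md
  -- the OV program on the split instance
  obtain ⟨out, hout, hMrun⟩ := hM (splitInst g.φ g.c)
  rw [OVWithDim_good_splitInst hmd, Set.mem_singleton_iff] at hout
  subst hout
  have hws : kM * (OVWithDim g.c).width (splitInst g.φ g.c) = g.ws := by
    rw [OVWithDim_width_splitInst _ (by show 1 ≤ 2 * c' + 2; omega)]; rfl
  rw [hws] at hMrun
  have hred := g.reduction_outputsWithin hF hwk hdet hof rfl hMrun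
  refine ⟨_, (kSATProblem_good_iff k φ _).2 rfl, hred.mono ?_⟩
  -- the time bound
  set n := g.n
  apply Nat.le_floor
  have hpos : (0 : ℝ) < (2 : ℝ) ^ (δ * n) := by positivity
  have hn0 : (0 : ℝ) ≤ n := Nat.cast_nonneg _
  have hsizeN : ((OVWithDim g.c).size (splitInst g.φ g.c) : ℝ) = g.N := by
    rw [OVWithDim_size_splitInst]; rfl
  have hNε : ((g.N : ℝ)) ^ (2 - ε) ≤ 2 * (2 : ℝ) ^ (δ * n) := by
    refine (g.N_rpow_le hε.le (by linarith)).trans ?_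
    exact mul_le_mul_of_nonneg_left (Real.rpow_le_rpow_of_exponent_le one_le_two
      (mul_le_mul_of_nonneg_right (by linarith) hn0)) (by norm_num)
  have hTM : ((⌊CM * ((OVWithDim g.c).size (splitInst g.φ g.c) : ℝ) ^ (2 - ε) + CM⌋₊ : ℕ) : ℝ) ≤
      3 * CM' * (2 : ℝ) ^ (δ * n) := by
    rw [hsizeN]
    have hfl := Nat.floor_le (a := CM' * (g.N : ℝ) ^ (2 - ε) + CM') (by positivity)
    have hmono : ⌊CM * (g.N : ℝ) ^ (2 - ε) + CM⌋₊ ≤ ⌊CM' * (g.N : ℝ) ^ (2 - ε) + CM'⌋₊ := by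
      refine Nat.floor_le_floor ?_
      have h1 : CM ≤ CM' := le_max_left _ _
      have h2 : (0 : ℝ) ≤ (g.N : ℝ) ^ (2 - ε) := Real.rpow_nonneg (Nat.cast_nonneg _) _
      nlinarith
    have hone : (1 : ℝ) ≤ (2 : ℝ) ^ (δ * n) := Real.one_le_rpow (by norm_num) (by positivity)
    calc ((⌊CM * (g.N : ℝ) ^ (2 - ε) + CM⌋₊ : ℕ) : ℝ) ≤ ((⌊CM' * (g.N : ℝ) ^ (2 - ε) + CM'⌋₊ : ℕ) : ℝ) := by
          exact_mod_cast hmono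
      _ ≤ CM' * (g.N : ℝ) ^ (2 - ε) + CM' := hfl
      _ ≤ CM' * (2 * (2 : ℝ) ^ (δ * n)) + CM' * (2 : ℝ) ^ (δ * n) :=
          add_le_add (mul_le_mul_of_nonneg_left hNε hCM'0) (le_mul_of_one_le_right hCM'0 hone)
      _ = 3 * CM' * (2 : ℝ) ^ (δ * n) := by ring
  have hB := g.Tpre_real_le hwk hm hη0.le hpoly
  have hexp : (1 / 2 + η) * (n : ℝ) = δ * n := by rw [hη]; ring
  rw [hexp] at hB
  unfold Params.Ttotal
  push_cast
  have hcs : (cstep : ℝ) = 38 := by norm_num [cstep]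
  rw [hcs]
  calc (g.Tpre k : ℝ) + 38 * ((⌊CM * ((OVWithDim g.c).size (splitInst g.φ g.c) : ℝ) ^ (2 - ε) + CM⌋₊ : ℕ) : ℝ) + 4
      ≤ Cb * (2 : ℝ) ^ (δ * n) + 38 * (3 * CM' * (2 : ℝ) ^ (δ * n)) := by linarith
    _ = (Cb + 114 * CM') * (2 : ℝ) ^ (δ * n) := by ring
    _ ≤ (Cb + 114 * CM') * (2 : ℝ) ^ (δ * n) + (Cb + 114 * CM') := by
        have : 0 ≤ Cb + 114 * CM' := by positivity
        linarith

end OVRed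

end Literature.Computability.FineGrained
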